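import Mathlib
import Literature.Probability.PointProcesses.LensConsistentLaw
import Literature.MathematicalPhysics.StatisticalMechanics.PeriodicConfigurationDelone
import HarnessLib

/-!
# Crux `PatternPricedCertificates` (stmt-AtomisticToContinuum-12974), line `registered` — stub `stub_periodicTransport`

This file discharges the registered tool stub `stub_periodicTransport` (T2) of line `registered`
for crux stmt-AtomisticToContinuum-12974
(`Summit.AtomisticToContinuum.Crystallization.Theses.FrustrationRangeCertificates.PatternPricedCertificates`).

**Statement (unimodularity of periodic configurations).** Let `Q` be a periodic configuration of
`ℝ³` (lattice of periods `G`, motif `F`, point set `Λ = F + G`). For a radius `ρ` and a centre `x`,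
the rooted `ρ`-pattern of `Q` at `x` is the finite set `PAT ρ x = {y − x | y ∈ Λ, y ≠ x, dist y x ≤ ρ}`
(spelled with `PeriodicConfiguration.finite_inter_points` of the closed `ρ`-ball about `x`). For a
level `(r, ρ)` with `0 ≤ r` and a rule `g`, the transport
`T_g S = Σ_{v ∈ lens r ρ S} [g v (B_r S) (B_r (reroot S v)) − g (−v) (B_r (reroot S v)) (B_r S)]`
(`B_r = ballPattern r`) vanishes on average over the motif: `Σ_{x ∈ F} T_g (PAT ρ x) = 0`
(mass-transport principle for periodic point sets, Aldous–Lyons).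

**Proof (folklore).**
* `periodicTransport_mem_pat`: `v ∈ PAT t x ↔ v + x ∈ Λ ∧ v ≠ 0 ∧ ‖v‖ ≤ t`;
* `periodicTransport_ballPattern_pat`: `B_r (PAT ρ x) = PAT r x` (`r ≤ ρ`);
* `periodicTransport_ballPattern_reroot_pat` (the lens): for `x ∈ Λ` and `‖v‖ ≤ ρ − r`,
  `B_r (reroot (PAT ρ x) v) = PAT r (v + x)`;
* `periodicTransport_pat_congr`: centres with the same patch of `Λ` (in particular centres that
  differ by a period) have the same pattern;
* `periodicTransport_sum_involution`: a double sum `Σ_{i ∈ s} Σ_{a ∈ t i} F i a` of a function odd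
  under an involution of the pairs vanishes (`Finset.sum_involution` on `s.sigma t`);
* the involution is `(x, v) ↦ (rep (v + x), −v)`, `rep` the motif representative
  (`periodicTransport_exists_rep`, unique by `eq_of_sub_mem`): it preserves the pairs
  `x ∈ F, v ∈ lens r ρ (PAT ρ x)`, squares to the identity (`periodicTransport_rep_reflect`), and
  exchanges the two halves of the summand because `PAT r (rep (v + x)) = PAT r (v + x)` and
  `PAT r (−v + rep (v + x)) = PAT r x` (lattice invariance).

No new definitions; nothing is assumed. [folklore]
-/

noncomputable section

open scoped BigOperators Classical

namespace Summit.AtomisticToContinuum.Crystallization.Theorems.PatternPricedCertificates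

open Literature.Probability.PointProcesses (ballPattern lens reroot)
open Literature.MathematicalPhysics.StatisticalMechanics (PeriodicConfiguration)

section Patterns

variable {E : Type*} [NormedAddCommGroup E] [DecidableEq E]

/-- Membership in the rooted `t`-pattern `{y − x | y ∈ Λ, y ≠ x, dist y x ≤ t}` of a set `Λ` at a
centre `x`: `v` belongs to it iff `v + x ∈ Λ`, `v ≠ 0` and `‖v‖ ≤ t`. [folklore] -/
theorem periodicTransport_mem_pat {Λ : Set E} {x : E} {t : ℝ}
    (h : (Metric.closedBall x t ∩ Λ).Finite) {v : E} :
    v ∈ (h.toFinset.erase x).image (fun y => y - x) ↔ v + x ∈ Λ ∧ v ≠ 0 ∧ ‖v‖ ≤ t := by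
  simp only [Finset.mem_image, Finset.mem_erase, Set.Finite.mem_toFinset, Set.mem_inter_iff,
    Metric.mem_closedBall]
  constructor
  · rintro ⟨y, ⟨hyx, hyt, hyΛ⟩, rfl⟩
    exact ⟨by rwa [sub_add_cancel], sub_ne_zero.2 hyx, by rwa [← dist_eq_norm]⟩
  · rintro ⟨hvΛ, hv0, hvt⟩
    refine ⟨v + x, ⟨fun hvx => hv0 (add_eq_right.1 hvx), ?_, hvΛ⟩, add_sub_cancel_right v x⟩
    rwa [dist_eq_norm, add_sub_cancel_right]

/-- Membership in the lens range `lens r t` of the rooted `t`-pattern at `x`, for `0 ≤ r`: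
`v + x ∈ Λ`, `v ≠ 0` and `‖v‖ ≤ t − r`. [folklore] -/
theorem periodicTransport_mem_lens_pat {Λ : Set E} {x : E} {t r : ℝ} (hr : 0 ≤ r)
    (h : (Metric.closedBall x t ∩ Λ).Finite) {v : E} :
    v ∈ lens r t ((h.toFinset.erase x).image (fun y => y - x)) ↔
      v + x ∈ Λ ∧ v ≠ 0 ∧ ‖v‖ ≤ t - r := by
  rw [lens, Finset.mem_filter, periodicTransport_mem_pat h]
  constructor
  · rintro ⟨⟨hvΛ, hv0, -⟩, hvs⟩
    exact ⟨hvΛ, hv0, hvs⟩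
  · rintro ⟨hvΛ, hv0, hvs⟩
    exact ⟨⟨hvΛ, hv0, hvs.trans (sub_le_self t hr)⟩, hvs⟩

/-- Cutting the rooted `t`-pattern at `x` to the closed `r`-ball, `r ≤ t`, gives the rooted
`r`-pattern at `x`. [folklore] -/
theorem periodicTransport_ballPattern_pat {Λ : Set E} {x : E} {t r : ℝ} (hrt : r ≤ t)
    {h : (Metric.closedBall x t ∩ Λ).Finite} (h' : (Metric.closedBall x r ∩ Λ).Finite) :
    ballPattern r ((h.toFinset.erase x).image (fun y => y - x)) =
      (h'.toFinset.erase x).image (fun y => y - x) := by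
  ext v
  rw [ballPattern, Finset.mem_filter, periodicTransport_mem_pat h, periodicTransport_mem_pat h']
  constructor
  · rintro ⟨⟨hvΛ, hv0, -⟩, hvr⟩
    exact ⟨hvΛ, hv0, hvr⟩
  · rintro ⟨hvΛ, hv0, hvr⟩
    exact ⟨⟨hvΛ, hv0, hvr.trans hrt⟩, hvr⟩

/-- **The lens.** For a centre `x ∈ Λ` and a displacement `v` with `‖v‖ ≤ t − r`, the `r`-ball of
the rooted `t`-pattern at `x` re-rooted at `v` is the rooted `r`-pattern at `v + x` (a point `w` of
the latter has `‖w + v‖ ≤ r + (t − r) = t`; the old root `x` becomes the point `−v`). [folklore] -/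
theorem periodicTransport_ballPattern_reroot_pat {Λ : Set E} {x v : E} {t r : ℝ} (hx : x ∈ Λ)
    (hv : ‖v‖ ≤ t - r) {h : (Metric.closedBall x t ∩ Λ).Finite}
    (h' : (Metric.closedBall (v + x) r ∩ Λ).Finite) :
    ballPattern r (reroot ((h.toFinset.erase x).image (fun y => y - x)) v) =
      (h'.toFinset.erase (v + x)).image (fun y => y - (v + x)) := by
  ext w
  rw [periodicTransport_mem_pat h', ballPattern, Finset.mem_filter, reroot, Finset.mem_erase,
    Finset.mem_image]
  simp only [Finset.mem_insert, periodicTransport_mem_pat h]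
  constructor
  · rintro ⟨⟨hw0, u, hu, rfl⟩, hwr⟩
    refine ⟨?_, hw0, hwr⟩
    rcases hu with rfl | ⟨huΛ, -, -⟩
    · rwa [zero_sub, neg_add_cancel_left]
    · have e : u - v + (v + x) = u + x := by abel
      rwa [e]
  · rintro ⟨hwΛ, hw0, hwr⟩
    refine ⟨⟨hw0, w + v, ?_, add_sub_cancel_right w v⟩, hwr⟩
    by_cases hu : w + v = 0
    · exact Or.inl hu
    · refine Or.inr ⟨by rwa [add_assoc], hu, ?_⟩
      calc ‖w + v‖ ≤ ‖w‖ + ‖v‖ := norm_add_le w v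
        _ ≤ r + (t - r) := add_le_add hwr hv
        _ = t := by ring

/-- Two centres with the same patch of `Λ` (`z + a ∈ Λ ↔ z + b ∈ Λ` for all `z`) have the same
rooted `t`-pattern. [folklore] -/
theorem periodicTransport_pat_congr {Λ : Set E} {a b : E} {t : ℝ}
    (hab : ∀ z, z + a ∈ Λ ↔ z + b ∈ Λ) {h : (Metric.closedBall a t ∩ Λ).Finite}
    (h' : (Metric.closedBall b t ∩ Λ).Finite) :
    (h.toFinset.erase a).image (fun y => y - a) = (h'.toFinset.erase b).image (fun y => y - b) := by
  ext v
  rw [periodicTransport_mem_pat h, periodicTransport_mem_pat h', hab]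

end Patterns

/-- **Mass transport for an involution of pairs.** If `(i, a) ↦ (φ i a, ψ i a)` maps the pairs
`i ∈ s, a ∈ t i` to such pairs, is an involution there, and `F` is odd under it, then
`Σ_{i ∈ s} Σ_{a ∈ t i} F i a = 0` (`Finset.sum_involution` on `s.sigma t`). [folklore] -/
theorem periodicTransport_sum_involution {ι α : Type*} (s : Finset ι) (t : ι → Finset α)
    (F : ι → α → ℝ) (φ : ι → α → ι) (ψ : ι → α → α)
    (hmem : ∀ i ∈ s, ∀ a ∈ t i, φ i a ∈ s ∧ ψ i a ∈ t (φ i a))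
    (hinv : ∀ i ∈ s, ∀ a ∈ t i, φ (φ i a) (ψ i a) = i ∧ ψ (φ i a) (ψ i a) = a)
    (hodd : ∀ i ∈ s, ∀ a ∈ t i, F i a + F (φ i a) (ψ i a) = 0) :
    ∑ i ∈ s, ∑ a ∈ t i, F i a = 0 := by
  rw [Finset.sum_sigma']
  refine Finset.sum_involution (fun p _ => (⟨φ p.1 p.2, ψ p.1 p.2⟩ : Σ _ : ι, α)) ?_ ?_ ?_ ?_
  · rintro ⟨i, a⟩ hp
    obtain ⟨hi, ha⟩ := Finset.mem_sigma.1 hp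
    exact hodd i hi a ha
  · rintro ⟨i, a⟩ hp hne hfix
    obtain ⟨hi, ha⟩ := Finset.mem_sigma.1 hp
    simp only [Sigma.mk.injEq, heq_eq_eq] at hfix
    apply hne
    have h0 := hodd i hi a ha
    rw [hfix.1, hfix.2] at h0
    show F i a = 0
    linarith
  · rintro ⟨i, a⟩ hp
    obtain ⟨hi, ha⟩ := Finset.mem_sigma.1 hp
    exact Finset.mem_sigma.2 (hmem i hi a ha)
  · rintro ⟨i, a⟩ hp
    obtain ⟨hi, ha⟩ := Finset.mem_sigma.1 hp
    obtain ⟨h1, h2⟩ := hinv i hi a ha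
    exact Sigma.ext h1 (heq_of_eq h2)

section Periodic

variable {d : ℕ} (Q : PeriodicConfiguration d)

/-- A motif representative map exists: every point `y` of `F + G` has `rep y ∈ F` with
`y − rep y ∈ G`. [folklore] -/
theorem periodicTransport_exists_rep :
    ∃ rep : EuclideanSpace ℝ (Fin d) → EuclideanSpace ℝ (Fin d),
      ∀ y ∈ Q.points, rep y ∈ Q.motif ∧ y - rep y ∈ Q.lattice := by
  have H : ∀ y : EuclideanSpace ℝ (Fin d), ∃ y₀ : EuclideanSpace ℝ (Fin d),
      y ∈ Q.points → y₀ ∈ Q.motif ∧ y - y₀ ∈ Q.lattice := by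
    intro y
    by_cases hy : y ∈ Q.points
    · obtain ⟨y₀, hy₀, γ, hγ, rfl⟩ := hy
      exact ⟨y₀, fun _ => ⟨hy₀, by rwa [add_sub_cancel_left]⟩⟩
    · exact ⟨0, fun h => absurd h hy⟩
  choose rep hrep using H
  exact ⟨rep, hrep⟩

/-- Uniqueness of the motif representative: if `z ∈ F + G`, `x ∈ F` and `z − x ∈ G`, then
`rep z = x` (motif points are pairwise inequivalent modulo `G`). [folklore] -/
theorem periodicTransport_rep_eq {rep : EuclideanSpace ℝ (Fin d) → EuclideanSpace ℝ (Fin d)}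
    (hrep : ∀ y ∈ Q.points, rep y ∈ Q.motif ∧ y - rep y ∈ Q.lattice)
    {z x : EuclideanSpace ℝ (Fin d)} (hz : z ∈ Q.points) (hx : x ∈ Q.motif)
    (hzx : z - x ∈ Q.lattice) : rep z = x := by
  obtain ⟨h1, h2⟩ := hrep z hz
  refine Q.eq_of_sub_mem _ h1 _ hx ?_
  have e : rep z - x = (z - x) - (z - rep z) := by abel
  rw [e]
  exact Q.lattice.sub_mem hzx h2

/-- Lattice invariance of the point set as a patch identity: if `b − a ∈ G` then
`z + a ∈ F + G ↔ z + b ∈ F + G`. [folklore] -/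
theorem periodicTransport_shift {a b : EuclideanSpace ℝ (Fin d)} (hab : b - a ∈ Q.lattice)
    (z : EuclideanSpace ℝ (Fin d)) : z + a ∈ Q.points ↔ z + b ∈ Q.points := by
  have e : z + b = z + a + (b - a) := by abel
  rw [e, Q.add_mem_points_iff hab]

/-- The reflected pair stays in the point set: for `x ∈ F` and `v + x ∈ F + G`,
`−v + rep (v + x) ∈ F + G`. [folklore] -/
theorem periodicTransport_reflect_mem
    {rep : EuclideanSpace ℝ (Fin d) → EuclideanSpace ℝ (Fin d)}
    (hrep : ∀ y ∈ Q.points, rep y ∈ Q.motif ∧ y - rep y ∈ Q.lattice)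
    {x v : EuclideanSpace ℝ (Fin d)} (hx : x ∈ Q.motif) (hvx : v + x ∈ Q.points) :
    -v + rep (v + x) ∈ Q.points := by
  rw [periodicTransport_shift Q (hrep (v + x) hvx).2 (-v), neg_add_cancel_left]
  exact Q.mem_points_of_mem_motif hx

/-- Reflecting twice is the identity on roots: `rep (−v + rep (v + x)) = x` for `x ∈ F` and
`v + x ∈ F + G`. [folklore] -/
theorem periodicTransport_rep_reflect
    {rep : EuclideanSpace ℝ (Fin d) → EuclideanSpace ℝ (Fin d)}
    (hrep : ∀ y ∈ Q.points, rep y ∈ Q.motif ∧ y - rep y ∈ Q.lattice)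
    {x v : EuclideanSpace ℝ (Fin d)} (hx : x ∈ Q.motif) (hvx : v + x ∈ Q.points) :
    rep (-v + rep (v + x)) = x := by
  refine periodicTransport_rep_eq Q hrep (periodicTransport_reflect_mem Q hrep hx hvx) hx ?_
  have e : -v + rep (v + x) - x = -((v + x) - rep (v + x)) := by abel
  rw [e]
  exact Q.lattice.neg_mem (hrep (v + x) hvx).2

end Periodic

/-- **Stub `stub_periodicTransport` (T2: unimodularity of periodic configurations — transports
vanish on average over the motif).** For every periodic `Q` of `ℝ³`, every level `(r, ρ)` with
`0 ≤ r` and every rule `g`, `Σ_{x ∈ motif} T^{(r,ρ)}_g (PAT ρ x) = 0`: the pairs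
`(x ∈ motif, v ∈ lens r ρ (PAT ρ x))` carry the involution `(x, v) ↦ (rep (v + x), −v)` (`rep` the
motif representative), under which the summand
`g v (B_r (PAT ρ x)) (B_r (reroot (PAT ρ x) v)) − g (−v) (B_r (reroot (PAT ρ x) v)) (B_r (PAT ρ x))
= g v (PAT r x) (PAT r (v + x)) − g (−v) (PAT r (v + x)) (PAT r x)` is odd (the lens identity and
lattice invariance of patterns; mass transport for periodic graphs, Aldous–Lyons). [folklore] -/
theorem stub_periodicTransport :
    ∀ (Q : Literature.MathematicalPhysics.StatisticalMechanics.PeriodicConfiguration 3) (r ρ : ℝ), 0 ≤ r → ∀ g : EuclideanSpace ℝ (Fin 3) → Finset (EuclideanSpace ℝ (Fin 3)) → Finset (EuclideanSpace ℝ (Fin 3)) → ℝ,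
      ∑ x ∈ Q.motif, (fun S : Finset (EuclideanSpace ℝ (Fin 3)) => ∑ v ∈ Literature.Probability.PointProcesses.lens r ρ S, (g v (Literature.Probability.PointProcesses.ballPattern r S) (Literature.Probability.PointProcesses.ballPattern r (Literature.Probability.PointProcesses.reroot S v)) - g (-v) (Literature.Probability.PointProcesses.ballPattern r (Literature.Probability.PointProcesses.reroot S v)) (Literature.Probability.PointProcesses.ballPattern r S)))
        (((Literature.MathematicalPhysics.StatisticalMechanics.PeriodicConfiguration.finite_inter_points Q (Metric.isBounded_closedBall (x := x) (r := ρ))).toFinset.erase x).image (fun y => y - x)) = 0 := by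
  intro Q r ρ hr g
  obtain ⟨rep, hrep⟩ := periodicTransport_exists_rep Q
  have hfin : ∀ (z : EuclideanSpace ℝ (Fin 3)) (t : ℝ), (Metric.closedBall z t ∩ Q.points).Finite :=
    fun z t => Q.finite_inter_points Metric.isBounded_closedBall
  beta_reduce
  refine periodicTransport_sum_involution Q.motif _ _
    (fun x v : EuclideanSpace ℝ (Fin 3) => rep (v + x)) (fun _ v : EuclideanSpace ℝ (Fin 3) => -v)
    ?_ ?_ ?_
  · intro x hx v hv
    obtain ⟨hvx, hv0, hvs⟩ := (periodicTransport_mem_lens_pat hr _).1 hv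
    exact ⟨(hrep (v + x) hvx).1, (periodicTransport_mem_lens_pat hr _).2
      ⟨periodicTransport_reflect_mem Q hrep hx hvx, neg_ne_zero.2 hv0, by rwa [norm_neg]⟩⟩
  · intro x hx v hv
    obtain ⟨hvx, -, -⟩ := (periodicTransport_mem_lens_pat hr _).1 hv
    exact ⟨periodicTransport_rep_reflect Q hrep hx hvx, neg_neg v⟩
  · intro x hx v hv
    obtain ⟨hvx, -, hvs⟩ := (periodicTransport_mem_lens_pat hr _).1 hv
    obtain ⟨hrep1, hrep2⟩ := hrep (v + x) hvx
    have hrρ : r ≤ ρ := by linarith [norm_nonneg v]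
    have hxp : x ∈ Q.points := Q.mem_points_of_mem_motif hx
    have hyp : rep (v + x) ∈ Q.points := Q.mem_points_of_mem_motif hrep1
    have hvs' : ‖-v‖ ≤ ρ - r := by rwa [norm_neg]
    have hlat : x - (-v + rep (v + x)) ∈ Q.lattice := by
      have e : x - (-v + rep (v + x)) = v + x - rep (v + x) := by abel
      rw [e]
      exact hrep2
    rw [periodicTransport_ballPattern_pat hrρ (hfin x r),
      periodicTransport_ballPattern_reroot_pat hxp hvs (hfin (v + x) r),
      periodicTransport_ballPattern_pat hrρ (hfin (rep (v + x)) r),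
      periodicTransport_ballPattern_reroot_pat hyp hvs' (hfin (-v + rep (v + x)) r),
      periodicTransport_pat_congr (periodicTransport_shift Q hrep2) (hfin (v + x) r),
      periodicTransport_pat_congr (periodicTransport_shift Q hlat) (hfin x r), neg_neg]
    abel

end Summit.AtomisticToContinuum.Crystallization.Theorems.PatternPricedCertificates

end
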